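import Mathlib

/-!
# Additive rigidity on a dense subset of an initial interval (Lemma L)

A purely combinatorial lemma, recorded for the Roy-type additive small-value nodes
(`SoloInformedRoyAdditiveDirichlet`): if a map `g : ℕ → G` into an additive commutative
group satisfies the restricted Cauchy equation `g (u + v) = g u + g v` whenever
`u, v, u + v` all lie in a set `U ⊆ [1, N]` missing at most `N / 50` points of `[1, N]`,
then `g` is linear on `U`: `g u = u • μ` for a single `μ ∈ G`.

This is the finite-interval analogue of the classical fact that an additive function on a
large (e.g. conull) set extends to an additive function on the whole group (compare
Kuczma, *An Introduction to the Theory of Functional Equations and Inequalities*, §13.6);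
no novelty is claimed.  The constants `200 ≤ N` and `1/50` are convenient, not optimal.

Proof outline.  Put `M = N / 4` and let `C = [1, N] \ U` be the exceptional set.
(0) For every `1 ≤ d ≤ M` pick an *anchor* pair `p, p + d ∈ U` with `p + d ≥ N - M`.
(A) Two anchor pairs with the same `d` have the same increment `g (p + d) - g p`
    (compare both with a common small `s`, `s + d ∈ U`).
(B) Every pair `a, a + d ∈ U` with `d ≤ M` has the anchor increment `c d`.
(C) `c (d + d') = c d + c d'`, hence `c d = d • μ` with `μ = c 1`.
(E) `g x - x • μ` is constant on `U` (gaps larger than `M` are split at a point of `U`).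
(F) The constant vanishes, by one application of additivity at `u, u', u + u' ∈ U`.
All counting is the pigeonhole principle `Finset.exists_mem_notMem_of_card_lt_card`
against unions of at most four translates / reflections of `C`.
-/

namespace Summit.Schanuel.Schanuel.Theorems

/-- **Lemma L (additive rigidity on a dense subset of `[1, N]`).**
Let `G` be an additive commutative group, `N ≥ 200`, `U ⊆ [1, N]` with
`50 · #([1, N] \ U) ≤ N`, and let `g : ℕ → G` satisfy `g (u + v) = g u + g v` whenever
`u, v, u + v ∈ U`.  Then there is `μ : G` with `g u = u • μ` for every `u ∈ U`. -/
theorem soloAR_additive_on_dense_interval_eq_nsmul {G : Type*} [AddCommGroup G] {N : ℕ}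
    (hN : 200 ≤ N) {U : Finset ℕ} (hU : U ⊆ Finset.Icc 1 N)
    (hC : 50 * (Finset.Icc 1 N \ U).card ≤ N) (g : ℕ → G)
    (hadd : ∀ u ∈ U, ∀ v ∈ U, u + v ∈ U → g (u + v) = g u + g v) :
    ∃ μ : G, ∀ u ∈ U, g u = u • μ := by
  classical
  -- the exceptional set `C` and the scale `M = N / 4`
  obtain ⟨C, hCdef⟩ : ∃ C : Finset ℕ, C = Finset.Icc 1 N \ U := ⟨_, rfl⟩
  have hCc : 50 * C.card ≤ N := by rw [hCdef]; exact hC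
  obtain ⟨M, hMdef⟩ : ∃ M : ℕ, M = N / 4 := ⟨_, rfl⟩
  -- membership in `U` from membership in `[1, N]` and non-membership in `C`
  have memU : ∀ x, 1 ≤ x → x ≤ N → x ∉ C → x ∈ U := by
    intro x h1 h2 h3
    by_contra h4
    exact h3 (by rw [hCdef]; exact Finset.mem_sdiff.mpr ⟨Finset.mem_Icc.mpr ⟨h1, h2⟩, h4⟩)
  have Usub : ∀ x ∈ U, 1 ≤ x ∧ x ≤ N := fun x hx => Finset.mem_Icc.mp (hU hx)
  -- translates and reflections of `C`
  have im_sub : ∀ a x, x + a ∈ C → x ∈ C.image (fun c => c - a) := by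
    intro a x h
    exact Finset.mem_image.mpr ⟨x + a, h, Nat.add_sub_cancel x a⟩
  have im_add : ∀ a x, a ≤ x → x - a ∈ C → x ∈ C.image (fun c => c + a) := by
    intro a x hax h
    exact Finset.mem_image.mpr ⟨x - a, h, Nat.sub_add_cancel hax⟩
  have im_rev : ∀ p x, x ≤ p → p - x ∈ C → x ∈ C.image (fun c => p - c) := by
    intro p x hxp h
    exact Finset.mem_image.mpr ⟨p - x, h, Nat.sub_sub_self hxp⟩
  -- cardinalities of unions of two / three / four copies of `C`
  have card2 : ∀ f : ℕ → ℕ, (C ∪ C.image f).card ≤ C.card + C.card := fun f =>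
    (Finset.card_union_le _ _).trans (add_le_add le_rfl Finset.card_image_le)
  have card3 : ∀ f f' : ℕ → ℕ, (C ∪ C.image f ∪ C.image f').card ≤ C.card + C.card + C.card :=
    fun f f' => (Finset.card_union_le _ _).trans (add_le_add (card2 f) Finset.card_image_le)
  have card4 : ∀ f f' f'' : ℕ → ℕ, (C ∪ C.image f ∪ C.image f' ∪ C.image f'').card
      ≤ C.card + C.card + C.card + C.card :=
    fun f f' f'' => (Finset.card_union_le _ _).trans (add_le_add (card3 f f') Finset.card_image_le)
  -- (0) anchors: for `1 ≤ d ≤ M` a pair `p, p + d ∈ U` with `N - M ≤ p + d ≤ N`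
  have anchor : ∀ d : ℕ, ∃ p : ℕ, (1 ≤ d → d ≤ M →
      (p ∈ U ∧ p + d ∈ U ∧ N - M ≤ p + d ∧ p + d ≤ N)) := by
    intro d
    by_cases hd : 1 ≤ d ∧ d ≤ M
    · obtain ⟨hd1, hdM⟩ := hd
      have hcard : (C ∪ C.image (fun c => c - d)).card
          < (Finset.Icc (N - M - d) (N - d)).card := by
        refine (card2 _).trans_lt ?_
        rw [Nat.card_Icc]; omega
      obtain ⟨p, hpI, hpB⟩ := Finset.exists_mem_notMem_of_card_lt_card hcard
      rw [Finset.mem_Icc] at hpI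
      rw [Finset.mem_union, not_or] at hpB
      refine ⟨p, fun _ _ => ⟨?_, ?_, by omega, by omega⟩⟩
      · exact memU p (by omega) (by omega) hpB.1
      · exact memU (p + d) (by omega) (by omega) (fun h => hpB.2 (im_sub d p h))
    · exact ⟨0, fun h1 h2 => absurd ⟨h1, h2⟩ hd⟩
  choose w hw using anchor
  -- (A) two anchor-zone pairs with the same difference have the same increment
  have stepA : ∀ d p q : ℕ, 1 ≤ d → d ≤ M →
      p ∈ U → p + d ∈ U → N - M ≤ p + d → p + d ≤ N →
      q ∈ U → q + d ∈ U → N - M ≤ q + d → q + d ≤ N →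
      g (p + d) - g p = g (q + d) - g q := by
    intro d p q hd1 hdM hp hpd hp1 hp2 hq hqd hq1 hq2
    have hcard : (C ∪ C.image (fun c => c - d) ∪ C.image (fun c => p - c)
        ∪ C.image (fun c => q - c)).card < (Finset.Ico 1 (N - 2 * M)).card := by
      refine (card4 _ _ _).trans_lt ?_
      rw [Nat.card_Ico]; omega
    obtain ⟨s, hsI, hsB⟩ := Finset.exists_mem_notMem_of_card_lt_card hcard
    rw [Finset.mem_Ico] at hsI
    simp only [Finset.mem_union, not_or] at hsB
    obtain ⟨⟨⟨hs1, hs2⟩, hs3⟩, hs4⟩ := hsB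
    have sU : s ∈ U := memU s (by omega) (by omega) hs1
    have sdU : s + d ∈ U :=
      memU (s + d) (by omega) (by omega) (fun h => hs2 (im_sub d s h))
    have psU : p - s ∈ U :=
      memU (p - s) (by omega) (by omega) (fun h => hs3 (im_rev p s (by omega) h))
    have qsU : q - s ∈ U :=
      memU (q - s) (by omega) (by omega) (fun h => hs4 (im_rev q s (by omega) h))
    have e1 : g (p + d) = g (s + d) + g (p - s) := by
      have h1 : s + d + (p - s) = p + d := by omega
      have := hadd (s + d) sdU (p - s) psU (by rw [h1]; exact hpd)
      rwa [h1] at this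
    have e2 : g p = g s + g (p - s) := by
      have h1 : s + (p - s) = p := by omega
      have := hadd s sU (p - s) psU (by rw [h1]; exact hp)
      rwa [h1] at this
    have e3 : g (q + d) = g (s + d) + g (q - s) := by
      have h1 : s + d + (q - s) = q + d := by omega
      have := hadd (s + d) sdU (q - s) qsU (by rw [h1]; exact hqd)
      rwa [h1] at this
    have e4 : g q = g s + g (q - s) := by
      have h1 : s + (q - s) = q := by omega
      have := hadd s sU (q - s) qsU (by rw [h1]; exact hq)
      rwa [h1] at this
    rw [e1, e2, e3, e4]; abel
  -- (B) every pair `a, a + d ∈ U` with `d ≤ M` has the anchor increment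
  have stepB : ∀ d a : ℕ, 1 ≤ d → d ≤ M → a ∈ U → a + d ∈ U →
      g (a + d) - g a = g (w d + d) - g (w d) := by
    intro d a hd1 hdM ha had
    obtain ⟨hw1, hw2, hw3, hw4⟩ := hw d hd1 hdM
    have haN := Usub (a + d) had
    have ha1 := Usub a ha
    by_cases hzone : N - M ≤ a + d
    · exact stepA d a (w d) hd1 hdM ha had hzone haN.2 hw1 hw2 hw3 hw4
    · have hlt : a + d < N - M := not_le.mp hzone
      have hcard : (C ∪ C.image (fun c => c - d) ∪ C.image (fun c => c + a)).card
          < (Finset.Icc (N - M - d) (N - d)).card := by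
        refine (card3 _ _).trans_lt ?_
        rw [Nat.card_Icc]; omega
      obtain ⟨p, hpI, hpB⟩ := Finset.exists_mem_notMem_of_card_lt_card hcard
      rw [Finset.mem_Icc] at hpI
      simp only [Finset.mem_union, not_or] at hpB
      obtain ⟨⟨hp1, hp2⟩, hp3⟩ := hpB
      have pU : p ∈ U := memU p (by omega) (by omega) hp1
      have pdU : p + d ∈ U :=
        memU (p + d) (by omega) (by omega) (fun h => hp2 (im_sub d p h))
      have paU : p - a ∈ U :=
        memU (p - a) (by omega) (by omega) (fun h => hp3 (im_add a p (by omega) h))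
      have e1 : g (p + d) = g (a + d) + g (p - a) := by
        have h1 : a + d + (p - a) = p + d := by omega
        have := hadd (a + d) had (p - a) paU (by rw [h1]; exact pdU)
        rwa [h1] at this
      have e2 : g p = g a + g (p - a) := by
        have h1 : a + (p - a) = p := by omega
        have := hadd a ha (p - a) paU (by rw [h1]; exact pU)
        rwa [h1] at this
      have e3 := stepA d p (w d) hd1 hdM pU pdU (by omega) (by omega) hw1 hw2 hw3 hw4
      rw [← e3, e1, e2]; abel
  -- (C) additivity of the anchor increments
  have stepC : ∀ d d' : ℕ, 1 ≤ d → 1 ≤ d' → d + d' ≤ M →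
      g (w (d + d') + (d + d')) - g (w (d + d'))
        = (g (w d + d) - g (w d)) + (g (w d' + d') - g (w d')) := by
    intro d d' hd hd' hM'
    have hcard : (C ∪ C.image (fun c => c - d) ∪ C.image (fun c => c - (d + d'))).card
        < (Finset.Icc 1 (N - (d + d'))).card := by
      refine (card3 _ _).trans_lt ?_
      rw [Nat.card_Icc]; omega
    obtain ⟨a, haI, haB⟩ := Finset.exists_mem_notMem_of_card_lt_card hcard
    rw [Finset.mem_Icc] at haI
    simp only [Finset.mem_union, not_or] at haB
    obtain ⟨⟨ha1, ha2⟩, ha3⟩ := haB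
    have aU : a ∈ U := memU a (by omega) (by omega) ha1
    have adU : a + d ∈ U :=
      memU (a + d) (by omega) (by omega) (fun h => ha2 (im_sub d a h))
    have addU : a + (d + d') ∈ U :=
      memU (a + (d + d')) (by omega) (by omega) (fun h => ha3 (im_sub (d + d') a h))
    have h1 := stepB (d + d') a (by omega) hM' aU addU
    have h2 := stepB d a hd (by omega) aU adU
    have h3 := stepB d' (a + d) hd' (by omega) adU (by rw [add_assoc]; exact addU)
    have h4 : g (a + (d + d')) = g (a + d + d') := by rw [add_assoc]
    rw [← h1, ← h2, ← h3, h4]; abel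
  -- the slope
  obtain ⟨μ, hμ⟩ : ∃ μ : G, μ = g (w 1 + 1) - g (w 1) := ⟨_, rfl⟩
  -- (D) `c d = d • μ` for `1 ≤ d ≤ M`
  have stepD : ∀ d : ℕ, 1 ≤ d → d ≤ M → g (w d + d) - g (w d) = d • μ := by
    intro d
    induction d with
    | zero => intro h; omega
    | succ k ih =>
      intro hk1 hkM
      by_cases hk : k = 0
      · subst hk
        simp only [Nat.zero_add, one_nsmul, hμ]
      · have ih' := ih (by omega) (by omega)
        have hC1 := stepC k 1 (by omega) le_rfl (by omega)
        rw [hC1, ih', ← hμ, succ_nsmul]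
  -- (E) `g x - x • μ` is constant on `U`
  have stepE : ∀ k : ℕ, ∀ a ∈ U, a + k ∈ U → g (a + k) - (a + k) • μ = g a - a • μ := by
    intro k
    induction k using Nat.strong_induction_on with
    | _ k ih =>
      intro a ha hak
      rcases Nat.eq_zero_or_pos k with hk | hk
      · subst hk; simp
      · by_cases hkM : k ≤ M
        · have h := stepB k a hk hkM ha hak
          rw [stepD k hk hkM] at h
          have h' : g (a + k) = g a + k • μ := by rw [← h]; abel
          rw [h', add_nsmul]; abel
        · have hMk : M < k := not_le.mp hkM
          have hakN := Usub (a + k) hak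
          have hcard : C.card < (Finset.Ioo a (a + k)).card := by
            rw [Nat.card_Ioo]; omega
          obtain ⟨u, huI, huC⟩ := Finset.exists_mem_notMem_of_card_lt_card hcard
          rw [Finset.mem_Ioo] at huI
          have uU : u ∈ U := memU u (by omega) (by omega) huC
          have hu1 : a + (u - a) = u := by omega
          have hu2 : u + (a + k - u) = a + k := by omega
          have h1 := ih (u - a) (by omega) a ha (by rw [hu1]; exact uU)
          have h2 := ih (a + k - u) (by omega) u uU (by rw [hu2]; exact hak)
          rw [hu1] at h1
          rw [hu2] at h2
          rw [h2, h1]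
  have errconst : ∀ x ∈ U, ∀ y ∈ U, g x - x • μ = g y - y • μ := by
    intro x hx y hy
    rcases le_total x y with hxy | hxy
    · have hxy' : x + (y - x) = y := by omega
      have := stepE (y - x) x hx (by rw [hxy']; exact hy)
      rw [hxy'] at this
      exact this.symm
    · have hxy' : y + (x - y) = x := by omega
      have := stepE (x - y) y hy (by rw [hxy']; exact hx)
      rw [hxy'] at this
      exact this
  -- (F) the constant vanishes: pick `u, u', u + u' ∈ U`
  have hcard1 : C.card < (Finset.Icc 1 (N / 3)).card := by
    rw [Nat.card_Icc]; omega
  obtain ⟨u', hu'I, hu'C⟩ := Finset.exists_mem_notMem_of_card_lt_card hcard1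
  rw [Finset.mem_Icc] at hu'I
  have u'U : u' ∈ U := memU u' (by omega) (by omega) hu'C
  have hcard2 : (C ∪ C.image (fun c => c - u')).card < (Finset.Icc 1 (N / 3)).card := by
    refine (card2 _).trans_lt ?_
    rw [Nat.card_Icc]; omega
  obtain ⟨u, huI, huB⟩ := Finset.exists_mem_notMem_of_card_lt_card hcard2
  rw [Finset.mem_Icc] at huI
  rw [Finset.mem_union, not_or] at huB
  have uU : u ∈ U := memU u (by omega) (by omega) huB.1
  have uu'U : u + u' ∈ U :=
    memU (u + u') (by omega) (by omega) (fun h => huB.2 (im_sub u' u h))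
  have key := hadd u uU u' u'U uu'U
  have h1 := errconst (u + u') uu'U u uU
  have h2 := errconst u' u'U u uU
  have e0 : g u - u • μ = 0 := by
    have hsum : g (u + u') - (u + u') • μ = (g u - u • μ) + (g u' - u' • μ) := by
      rw [key, add_nsmul]; abel
    rw [h1, h2] at hsum
    calc g u - u • μ = ((g u - u • μ) + (g u - u • μ)) - (g u - u • μ) := by abel
      _ = (g u - u • μ) - (g u - u • μ) := by rw [← hsum]
      _ = 0 := sub_self _
  refine ⟨μ, fun x hx => ?_⟩
  have hx' := errconst x hx u uU
  rw [e0, sub_eq_zero] at hx'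
  exact hx'

end Summit.Schanuel.Schanuel.Theorems
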